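import Literature.Probability.LatticeModels.IsingLaceSecondParity
import HarnessLib

/-!
# Sakai's second expansion, (2.32)–(2.33): conditioning on `𝒞^b_{m+n}(v)` for pairs of currents

Topic `Probability/LatticeModels`, grouping namespace `IsingLace`. Fourth file of the proof of the
second-expansion identity (2.35) of A. Sakai, *Lace expansion for the Ising model* (the tree's named
fact `IsingLace.Sakai2007_secondExpansion`). After the parity flip (2.31), "as in (2.14), we
condition on `𝒞^b_{m+n}(v) = ℬ` and decouple events occurring on `𝔹_{ℬᶜ}` from events occurring on
`𝔹_Λ ∖ 𝔹_{ℬᶜ}` … Multiplying by `(Z_{𝒜ᶜ∩ℬᶜ}/Z_{𝒜ᶜ∩ℬᶜ})(Z_{ℬᶜ}/Z_{ℬᶜ}) ≡ 1` … we have been able to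
perform the sum over `m''` and `n''` independently, due to the fact that
`1{b̄ ⟷_{m''+n''} x in ℬᶜ} ≡ 1` for any `n'' ∈ ℤ₊^{𝔹_{ℬᶜ}}` with `∂n'' = b̄ △ x`" ((2.32)–(2.33)).
Proved here (uniform coupling `β ≥ 0`, finite graph, sums in `ℝ≥0∞`), with the restricted current
`m` (`m ⊆ 𝔹_{𝒜ᶜ}`, `∂m = ∅`) riding along unchanged — only the part of `n` off the frozen cluster is
traded, which is enough because `E_{(m+n)∖b}(v, b̲; 𝒜)` and the cluster only see the bonds meeting
the cluster (`laceEvent_congr_of_agree`):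

* `transfer_forward₂`, `transfer_backward₂` — the weight-preserving involution
  `(n, k) ↦ (spliceOff ℬ n k, spliceOff ℬ k n)` (the tree's `Current.splice_transfer`) exchanges
  the constraint sets of the two sides;
* `conditioning_identity₂` — the cross-multiplied conditioning identity at a frozen cluster
  `𝒞^b_{m+n}(v) = ℬ` (pair version of the tree's `conditioning_identity` for (2.14)–(2.15));
* `frozen_cluster_eq₂` — division by `Z_{ℬᶜ}`: the inner sums produce `⟨φ_b̄ φ_x⟩_{ℬᶜ}`;
* `tsum_pair_conditioning` — **(2.31) → (2.33)**: un-conditioning `Σ_ℬ 1{𝒞^b_{m+n}(v) = ℬ}`,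
  `Σ_{(m,n)} w_{𝒜ᶜ}(m) w(n) 1{∂n = v△x△b̲△b̄, m_b, n_b even} 1{E_{(m+n)∖b}(v,b̲;𝒜)} 1{b̄ ⟷ x in 𝒞ᶜ}`
  `= Σ_{(m,n)} w_{𝒜ᶜ}(m) w(n) 1{∂n = v△b̲, m_b, n_b even} 1{E_{(m+n)∖b}(v,b̲;𝒜)} ⟨φ_b̄ φ_x⟩_{𝒞^b_{m+n}(v)ᶜ}`.

## References

* A. Sakai, *Lace expansion for the Ising model*, Comm. Math. Phys. 272 (2007) 283–344,
  arXiv:math-ph/0510093: §2.2.2, (2.31)–(2.33) [Sakai2007].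
(Equation numbers are those of the arXiv version held in the literature store, every display
counted.)
-/

noncomputable section

open Finset
open scoped symmDiff ENNReal BigOperators

namespace Literature.Probability.LatticeModels

variable {V : Type*} [Fintype V] [DecidableEq V] {G : SimpleGraph V} [DecidableRel G.Adj]

namespace IsingLace

/-! ## Bookkeeping for `(m + n) ∖ b` -/

/-- Resetting a bond is additive: `(m + n) ∖ b = (m ∖ b) + (n ∖ b)`. [folklore] -/
theorem update_add_eq (m n : Current G) (b : G.edgeFinset) :
    Function.update (m + n) b 0 = Function.update m b 0 + Function.update n b 0 := by
  funext e
  by_cases he : e = b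
  · subst he
    rw [Pi.add_apply, Function.update_self, Function.update_self, Function.update_self]
  · rw [Function.update_of_ne he, Pi.add_apply, Pi.add_apply, Function.update_of_ne he,
      Function.update_of_ne he]

/-- Agreement of `(m + n') ∖ b` with `(m + n) ∖ b` on the bonds meeting `S` when `n'` agrees with `n`
there. [folklore] -/
theorem agree_update_add_spliceOff (m n k : Current G) (S : Finset V) (b : G.edgeFinset) :
    ∀ e : G.edgeFinset, ¬Current.EdgeOff S (e : Sym2 V) →
      Function.update (m + Current.spliceOff S n k) b 0 e = Function.update (m + n) b 0 e := by
  intro e he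
  by_cases heb : e = b
  · subst heb
    rw [Function.update_self, Function.update_self]
  · rw [Function.update_of_ne heb, Function.update_of_ne heb, Pi.add_apply, Pi.add_apply,
      Current.spliceOff_apply_of_not_edgeOff _ _ he]

/-! ## The transfer for pairs -/

section Transfer

variable {β : ℝ} {S : Finset V} {v u w x : V} {b : G.edgeFinset} {A : Finset V}

/-- Common bookkeeping: from `E_{(m+n)∖b}(v, b̲; 𝒜)`, `𝒞^b_{m+n}(v) = S` and `n_b` even —
`b̲, v ∈ S`, `b` meets `S`, `C_{(m∖b)+(n∖b)}(v) = S` and `∂(n ∖ b) = ∂n`. [folklore] -/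
theorem transfer_prelim (hb : (b : Sym2 V) = s(u, w)) {m n : Current G} (heven : Even (n b))
    (hE : laceEvent G (Function.update (m + n) b 0) A v u) (hcl : clusterOff G (m + n) b v = S) :
    u ∈ S ∧ v ∈ S ∧ ¬Current.EdgeOff S (b : Sym2 V) ∧
      Current.cluster (Function.update m b 0 + Function.update n b 0) v = S ∧
        Current.sources (Function.update n b 0) = n.sources := by
  have huS : u ∈ S := by
    have h := hE.1.1
    rw [conn_iff_mem_cluster, ← clusterOff_eq, hcl] at h
    exact h
  refine ⟨huS, hcl ▸ mem_clusterOff_self (m + n) b v, fun ho => ?_, ?_, ?_⟩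
  · rw [hb, Current.edgeOff_mk] at ho
    exact ho.1 huS
  · rw [← update_add_eq, ← clusterOff_eq]
    exact hcl
  · have h := sources_eq_symmDiff_update n b hb
    rw [if_neg (Nat.not_odd_iff_even.2 heven), ← Finset.bot_eq_empty, symmDiff_bot] at h
    exact h.symm

/-- **Transfer, forward direction** (pair version): from the constraints of the left side of the
conditioning identity on `(m, n)` and a sourceless `k ⊆ 𝔹_{Sᶜ}`, the spliced pair
`(spliceOff S n k, spliceOff S k n)` satisfies the constraints of the right side, `m` unchanged.
[cite: Sakai2007, (2.32)–(2.33)] -/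
theorem transfer_forward₂ (hb : (b : Sym2 V) = s(u, w)) (hw : w ∉ S) (hx : x ∉ S) {m n k : Current G}
    (hn : n.sources = (({v} : Finset V) ∆ {x}) ∆ ({u} ∆ {w}) ∧ Even (n b) ∧
      laceEvent G (Function.update (m + n) b 0) A v u ∧ clusterOff G (m + n) b v = S ∧
        ConnAvoid G (m + n) S w x)
    (hk : Current.IsSupp (offGraph G S) k ∧ k.sources = ∅) :
    (Current.sources (Current.spliceOff S n k) = ({v} : Finset V) ∆ {u} ∧
      Even (Current.spliceOff S n k b) ∧
      laceEvent G (Function.update (m + Current.spliceOff S n k) b 0) A v u ∧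
        clusterOff G (m + Current.spliceOff S n k) b v = S) ∧
    (Current.IsSupp (offGraph G S) (Current.spliceOff S k n) ∧
      Current.sources (Current.spliceOff S k n) = ({w} : Finset V) ∆ {x}) := by
  obtain ⟨hsn, heven, hE, hcl, -⟩ := hn
  obtain ⟨hksupp, hks⟩ := hk
  obtain ⟨huS, hvS, hbS, hclu, hsn0⟩ := transfer_prelim hb heven hE hcl
  obtain ⟨hC', hk', hsk', hsn'⟩ := Current.splice_transfer (n₁ := Function.update m b 0)
    (n₂ := Function.update n b 0) (k := k) (x := v) (S := S) hclu hksupp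
  rw [spliceOff_update_left n k hbS] at hC' hsn'
  rw [spliceOff_update_right k n hbS] at hk' hsk'
  rw [hsn0, hks, Finset.filter_empty, Finset.union_empty] at hsn'
  rw [hsn0] at hsk'
  have hb' : Current.spliceOff S n k b = n b := Current.spliceOff_apply_of_not_edgeOff _ _ hbS
  have heven' : Even (Current.spliceOff S n k b) := by rw [hb']; exact heven
  refine ⟨⟨?_, heven', ?_, ?_⟩, hk', ?_⟩
  · have h := sources_eq_symmDiff_update (Current.spliceOff S n k) b hb
    rw [if_neg (Nat.not_odd_iff_even.2 heven'), ← Finset.bot_eq_empty, symmDiff_bot] at h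
    rw [h, hsn', hsn, filter_mem_four hvS huS hw hx]
  · refine (laceEvent_congr_of_agree (M := Function.update (m + n) b 0)
      (M' := Function.update (m + Current.spliceOff S n k) b 0) (S := S) ?_
      (agree_update_add_spliceOff m n k S b) huS).1 hE
    rw [← clusterOff_eq]
    exact hcl
  · rw [clusterOff_eq, update_add_eq]
    exact hC'
  · rw [hsk', hsn, filter_notMem_four hvS huS hw hx]

/-- **Transfer, backward direction** (pair version): from the constraints of the right side on
`(m, n)` and `k ⊆ 𝔹_{Sᶜ}` with `∂k = b̄ △ x`, the spliced pair satisfies those of the left side;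
"`b̄ ⟷ x in Sᶜ`" holds automatically, the sources `b̄ △ x` of the outer current forcing the
connection. [cite: Sakai2007, (2.32)–(2.33)] -/
theorem transfer_backward₂ (hb : (b : Sym2 V) = s(u, w)) (hw : w ∉ S) (hx : x ∉ S) {m n k : Current G}
    (hn : n.sources = ({v} : Finset V) ∆ {u} ∧ Even (n b) ∧
      laceEvent G (Function.update (m + n) b 0) A v u ∧ clusterOff G (m + n) b v = S)
    (hk : Current.IsSupp (offGraph G S) k ∧ k.sources = ({w} : Finset V) ∆ {x}) :
    (Current.sources (Current.spliceOff S n k) = (({v} : Finset V) ∆ {x}) ∆ ({u} ∆ {w}) ∧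
      Even (Current.spliceOff S n k b) ∧
      laceEvent G (Function.update (m + Current.spliceOff S n k) b 0) A v u ∧
        clusterOff G (m + Current.spliceOff S n k) b v = S ∧
          ConnAvoid G (m + Current.spliceOff S n k) S w x) ∧
    (Current.IsSupp (offGraph G S) (Current.spliceOff S k n) ∧
      Current.sources (Current.spliceOff S k n) = ∅) := by
  obtain ⟨hsn, heven, hE, hcl⟩ := hn
  obtain ⟨hksupp, hks⟩ := hk
  obtain ⟨huS, hvS, hbS, hclu, hsn0⟩ := transfer_prelim hb heven hE hcl
  obtain ⟨hC', hk', hsk', hsn'⟩ := Current.splice_transfer (n₁ := Function.update m b 0)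
    (n₂ := Function.update n b 0) (k := k) (x := v) (S := S) hclu hksupp
  rw [spliceOff_update_left n k hbS] at hC' hsn'
  rw [spliceOff_update_right k n hbS] at hk' hsk'
  rw [hsn0, hsn, (filter_two_of_mem hvS huS).1, hks, filter_two_of_notMem hw hx,
    two_union_two_eq_four hvS huS hw hx] at hsn'
  rw [hsn0, hsn, (filter_two_of_mem hvS huS).2] at hsk'
  have hb' : Current.spliceOff S n k b = n b := Current.spliceOff_apply_of_not_edgeOff _ _ hbS
  have heven' : Even (Current.spliceOff S n k b) := by rw [hb']; exact heven
  refine ⟨⟨?_, heven', ?_, ?_, ?_⟩, hk', hsk'⟩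
  · have h := sources_eq_symmDiff_update (Current.spliceOff S n k) b hb
    rw [if_neg (Nat.not_odd_iff_even.2 heven'), ← Finset.bot_eq_empty, symmDiff_bot] at h
    rw [h, hsn']
  · refine (laceEvent_congr_of_agree (M := Function.update (m + n) b 0)
      (M' := Function.update (m + Current.spliceOff S n k) b 0) (S := S) ?_
      (agree_update_add_spliceOff m n k S b) huS).1 hE
    rw [← clusterOff_eq]
    exact hcl
  · rw [clusterOff_eq, update_add_eq]
    exact hC'
  · -- the outer current `k` (sources `b̄ △ x`, supported off `S`) forces `b̄ ⟷ x` off `S`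
    have hle : k ≤ m + Current.spliceOff S n k := fun e => by
      by_cases he : Current.EdgeOff S (e : Sym2 V)
      · rw [Pi.add_apply, Current.spliceOff_apply_of_edgeOff _ _ he]
        exact Nat.le_add_left _ _
      · rw [isSupp_offGraph_iff.1 hksupp e he]
        exact Nat.zero_le _
    have h := Current.add_mem_connIn_of_sources_eq (offGraph G S) hksupp hks
      (m + Current.spliceOff S n k - k)
    rw [add_tsub_cancel_of_le hle] at h
    exact ⟨hw, hx, h⟩

end Transfer

/-! ## The conditioning identity for pairs -/

/-- **Reindexing a constrained sum by a weight-preserving involution** exchanging two constraint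
sets (the mechanism of the tree's `conditioning_identity` and `Current.cluster_decomposition`).
[folklore] -/
theorem tsum_ite_eq_of_involutive {X : Type*} (f : X → X) (hinv : Function.Involutive f)
    (PA PB : X → Prop) [DecidablePred PA] [DecidablePred PB] (W : X → ℝ≥0∞)
    (hW : ∀ q, W (f q) = W q) (hAB : ∀ q, PA q → PB (f q)) (hBA : ∀ q, PB q → PA (f q)) :
    ∑' q, (if PA q then W q else 0) = ∑' q, (if PB q then W q else 0) := by
  rw [← (hinv.toPerm f).tsum_eq (fun q => if PB q then W q else 0)]
  refine tsum_congr fun q => ?_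
  change (if PA q then W q else 0) = (if PB (f q) then W (f q) else 0)
  by_cases hA : PA q
  · rw [if_pos hA, if_pos (hAB q hA), hW]
  · have hB : ¬PB (f q) := fun hB => hA (by simpa [hinv q] using hBA (f q) hB)
    rw [if_neg hA, if_neg hB]

open Classical in
/-- **The conditioning identity at a frozen cluster `𝒞^b_{m+n}(v) = S`, for pairs**
(cross-multiplied by `Z_{Sᶜ}`): for `β ≥ 0`, `b = s(b̲, b̄)` and `b̄, x ∉ S`,
`(Σ_{(m,n)} w_{𝒜ᶜ}(m) w(n) 1{∂n = v△x△b̲△b̄, n_b, m_b even, E_{(m+n)∖b}(v,b̲;𝒜), 𝒞^b_{m+n}(v) = S, b̄ ⟷ x in Sᶜ}) · Z_{Sᶜ}`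
`= (Σ_{(m,n)} w_{𝒜ᶜ}(m) w(n) 1{∂n = v△b̲, n_b, m_b even, E_{(m+n)∖b}(v,b̲;𝒜), 𝒞^b_{m+n}(v) = S}) · Σ_{∂k = b̄△x, k ⊆ 𝔹_{Sᶜ}} w(k)`
(`w_{𝒜ᶜ}(m) = 1{m ⊆ 𝔹_{𝒜ᶜ}, ∂m = ∅} w(m)`), by the weight-preserving involution
`((m,n),k) ↦ ((m, spliceOff S n k), spliceOff S k n)`. [cite: Sakai2007, (2.32)–(2.33)] -/
theorem conditioning_identity₂ {β : ℝ} (hβ : 0 ≤ β) {S : Finset V} {v u w x : V} (b : G.edgeFinset)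
    (hb : (b : Sym2 V) = s(u, w)) (hw : w ∉ S) (hx : x ∉ S) (A : Finset V) :
    (∑' p : Current G × Current G,
        if (Current.IsSupp (offGraph G A) p.1 ∧ p.1.sources = ∅) ∧
            (p.2.sources = (({v} : Finset V) ∆ {x}) ∆ ({u} ∆ {w}) ∧ Even (p.2 b) ∧ Even (p.1 b) ∧
              laceEvent G (Function.update (p.1 + p.2) b 0) A v u ∧ clusterOff G (p.1 + p.2) b v = S ∧
                ConnAvoid G (p.1 + p.2) S w x)
          then ENNReal.ofReal (p.1.weight β) * ENNReal.ofReal (p.2.weight β) else 0) *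
      (∑' k : Current G, if Current.IsSupp (offGraph G S) k ∧ k.sources = ∅
        then ENNReal.ofReal (k.weight β) else 0) =
    (∑' p : Current G × Current G,
        if (Current.IsSupp (offGraph G A) p.1 ∧ p.1.sources = ∅) ∧
            (p.2.sources = ({v} : Finset V) ∆ {u} ∧ Even (p.2 b) ∧ Even (p.1 b) ∧
              laceEvent G (Function.update (p.1 + p.2) b 0) A v u ∧ clusterOff G (p.1 + p.2) b v = S)
          then ENNReal.ofReal (p.1.weight β) * ENNReal.ofReal (p.2.weight β) else 0) *
      (∑' k : Current G, if Current.IsSupp (offGraph G S) k ∧ k.sources = ({w} : Finset V) ∆ {x}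
        then ENNReal.ofReal (k.weight β) else 0) := by
  have hK : ∀ _e : G.edgeFinset, 0 ≤ β := fun _ => hβ
  rw [tsum_mul_tsum_eq_tsum_prod, tsum_mul_tsum_eq_tsum_prod]
  simp only [ite_zero_mul_ite_zero]
  refine tsum_ite_eq_of_involutive
    (fun q : (Current G × Current G) × Current G =>
      ((q.1.1, Current.spliceOff S q.1.2 q.2), Current.spliceOff S q.2 q.1.2)) ?_ _ _ _ ?_ ?_ ?_
  · rintro ⟨⟨m, n⟩, k⟩
    simp only [Current.spliceOff_spliceOff]
  · rintro ⟨⟨m, n⟩, k⟩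
    simp only [ofReal_weight_eq_eweight, mul_assoc]
    rw [Current.eweight_spliceOff_mul_eweight_spliceOff hK S n k]
  · rintro ⟨⟨m, n⟩, k⟩ ⟨⟨hm, hn⟩, hk⟩
    obtain ⟨h1, h2⟩ := transfer_forward₂ (A := A) hb hw hx
      ⟨hn.1, hn.2.1, hn.2.2.2.1, hn.2.2.2.2.1, hn.2.2.2.2.2⟩ hk
    exact ⟨⟨hm, h1.1, h1.2.1, hn.2.2.1, h1.2.2.1, h1.2.2.2⟩, h2⟩
  · rintro ⟨⟨m, n⟩, k⟩ ⟨⟨hm, hn⟩, hk⟩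
    obtain ⟨h1, h2⟩ := transfer_backward₂ (A := A) hb hw hx
      ⟨hn.1, hn.2.1, hn.2.2.2.1, hn.2.2.2.2⟩ hk
    exact ⟨⟨hm, h1.1, h1.2.1, hn.2.2.1, h1.2.2.1, h1.2.2.2.1, h1.2.2.2.2⟩, h2⟩

open Classical in
/-- **The frozen-cluster identity for pairs** ((2.32) → (2.33) at `𝒞^b_{m+n}(v) = S`, divided by
`Z_{Sᶜ}`): the inner sum over the currents off `S` produces `⟨φ_b̄ φ_x⟩_{Sᶜ}` (both sides vanish
unless `b̄, x ∉ S`). [cite: Sakai2007, (2.32)–(2.33)] -/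
theorem frozen_cluster_eq₂ {β : ℝ} (hβ : 0 ≤ β) {v u w : V} (x : V) (b : G.edgeFinset)
    (hb : (b : Sym2 V) = s(u, w)) (A : Finset V) (S : Finset V) :
    ∑' p : Current G × Current G,
        (if (Current.IsSupp (offGraph G A) p.1 ∧ p.1.sources = ∅) ∧
            (p.2.sources = (({v} : Finset V) ∆ {x}) ∆ ({u} ∆ {w}) ∧ Even (p.2 b) ∧ Even (p.1 b) ∧
              laceEvent G (Function.update (p.1 + p.2) b 0) A v u ∧ clusterOff G (p.1 + p.2) b v = S ∧
                ConnAvoid G (p.1 + p.2) S w x)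
          then ENNReal.ofReal (p.1.weight β) * ENNReal.ofReal (p.2.weight β) else 0) =
      (∑' p : Current G × Current G,
        (if (Current.IsSupp (offGraph G A) p.1 ∧ p.1.sources = ∅) ∧
            (p.2.sources = ({v} : Finset V) ∆ {u} ∧ Even (p.2 b) ∧ Even (p.1 b) ∧
              laceEvent G (Function.update (p.1 + p.2) b 0) A v u ∧ clusterOff G (p.1 + p.2) b v = S)
          then ENNReal.ofReal (p.1.weight β) * ENNReal.ofReal (p.2.weight β) else 0)) *
        ENNReal.ofReal (twoPointOff G β S w x) := by
  by_cases hwx : w ∉ S ∧ x ∉ S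
  · have hci := conditioning_identity₂ hβ b hb hwx.1 hwx.2 A (v := v)
    set Z := ∑' k : Current G, (if Current.IsSupp (offGraph G S) k ∧ Current.sources k = ∅
      then ENNReal.ofReal (Current.weight β k) else 0) with hZ
    set M := ∑' k : Current G, (if Current.IsSupp (offGraph G S) k ∧
      Current.sources k = ({w} : Finset V) ∆ {x} then ENNReal.ofReal (Current.weight β k) else 0) with hM
    have hZeq : ENNReal.ofReal (zOff G β S) = Z := ofReal_zOff_eq hβ S
    have hZ0 : Z ≠ 0 := by
      rw [← hZeq]; exact (ENNReal.ofReal_pos.2 (zOff_pos β S)).ne'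
    have hZtop : Z ≠ ⊤ := by rw [← hZeq]; exact ENNReal.ofReal_ne_top
    have htpo : ENNReal.ofReal (twoPointOff G β S w x) = M / Z := by
      rw [twoPointOff_eq_tsum_div β S hwx.1 hwx.2, ENNReal.ofReal_div_of_pos (zOff_pos β S), hZeq,
        ofReal_tsum_isSupp_eq β hβ]
    rw [htpo, ← mul_div_assoc, ENNReal.eq_div_iff hZ0 hZtop, mul_comm Z, hci]
  · rw [twoPointOff_of_not β hwx, ENNReal.ofReal_zero, mul_zero]
    refine ENNReal.tsum_eq_zero.2 fun p => if_neg ?_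
    rintro ⟨-, -, -, -, -, -, hav⟩
    exact hwx ⟨(connAvoid_iff.1 hav).1, (connAvoid_iff.1 hav).2.1⟩

/-! ## Un-conditioning and the passage (2.31) → (2.33) -/

open Classical in
/-- **Un-conditioning for pairs** `Σ_ℬ 1{𝒞^b_{m+n}(v) = ℬ}`. [cite: Sakai2007, (2.32) (summing over ℬ ⊂ Λ)] -/
theorem tsum_pair_eq_sum_tsum_ite_clusterOff (b : G.edgeFinset) (v : V)
    (F : Current G × Current G → Finset V → ℝ≥0∞) :
    ∑' p : Current G × Current G, F p (clusterOff G (p.1 + p.2) b v) =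
      ∑ S : Finset V, ∑' p : Current G × Current G,
        if clusterOff G (p.1 + p.2) b v = S then F p S else 0 := by
  rw [← Summable.tsum_finsetSum (fun S _ => ENNReal.summable)]
  refine tsum_congr fun p => ?_
  rw [Finset.sum_eq_single (clusterOff G (p.1 + p.2) b v) (fun S _ hS => if_neg (Ne.symm hS))
    (fun h => absurd (Finset.mem_univ _) h), if_pos rfl]

open Classical in
/-- **(2.31) → (2.33)** — conditioning on `𝒞^b_{m+n}(v) = ℬ`, decoupling and resumming the bonds
off `ℬ`: for `β ≥ 0` and a directed bond `b = (b̲, b̄)`,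
`Σ_{(m,n)} w_{𝒜ᶜ}(m) w(n) 1{∂n = v△x△b̲△b̄, n_b, m_b even} 1{E_{(m+n)∖b}(v,b̲;𝒜)} 1{b̄ ⟷_{m+n} x in 𝒞^b_{m+n}(v)ᶜ}`
`= Σ_{(m,n)} w_{𝒜ᶜ}(m) w(n) 1{∂n = v△b̲, n_b, m_b even} 1{E_{(m+n)∖b}(v,b̲;𝒜)} ⟨φ_b̄ φ_x⟩_{𝒞^b_{m+n}(v)ᶜ}`
(`w_{𝒜ᶜ}(m) = 1{m ⊆ 𝔹_{𝒜ᶜ}, ∂m = ∅} w(m)`). [cite: Sakai2007, (2.31)–(2.33)] -/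
theorem tsum_pair_conditioning {β : ℝ} (hβ : 0 ≤ β) (A : Finset V) (v x : V) (d : G.Dart) :
    ∑' p : Current G × Current G,
        (if Current.IsSupp (offGraph G A) p.1 ∧ p.1.sources = ∅ then ENNReal.ofReal (p.1.weight β) else 0) *
        (if p.2.sources = (({v} : Finset V) ∆ {x}) ∆ ({d.fst} ∆ {d.snd}) ∧ Even (p.2 (dartEdge G d)) ∧
            Even (p.1 (dartEdge G d)) ∧
              laceEvent G (Function.update (p.1 + p.2) (dartEdge G d) 0) A v d.fst ∧
                ConnAvoid G (p.1 + p.2) (clusterOff G (p.1 + p.2) (dartEdge G d) v) d.snd x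
          then ENNReal.ofReal (p.2.weight β) else 0) =
      ∑' p : Current G × Current G,
        (if Current.IsSupp (offGraph G A) p.1 ∧ p.1.sources = ∅ then ENNReal.ofReal (p.1.weight β) else 0) *
        (if p.2.sources = ({v} : Finset V) ∆ {d.fst} ∧ Even (p.2 (dartEdge G d)) ∧
            Even (p.1 (dartEdge G d)) ∧
              laceEvent G (Function.update (p.1 + p.2) (dartEdge G d) 0) A v d.fst
          then ENNReal.ofReal (p.2.weight β) *
            ENNReal.ofReal (twoPointOff G β (clusterOff G (p.1 + p.2) (dartEdge G d) v) d.snd x) else 0) := by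
  have hb : ((dartEdge G d : G.edgeFinset) : Sym2 V) = s(d.fst, d.snd) := rfl
  simp only [ite_zero_mul_ite_zero]
  -- un-condition on the cluster
  have step1 := tsum_pair_eq_sum_tsum_ite_clusterOff (dartEdge G d) v fun p S =>
    if (Current.IsSupp (offGraph G A) p.1 ∧ p.1.sources = ∅) ∧
        (p.2.sources = (({v} : Finset V) ∆ {x}) ∆ ({d.fst} ∆ {d.snd}) ∧ Even (p.2 (dartEdge G d)) ∧
          Even (p.1 (dartEdge G d)) ∧
            laceEvent G (Function.update (p.1 + p.2) (dartEdge G d) 0) A v d.fst ∧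
              ConnAvoid G (p.1 + p.2) S d.snd x)
      then ENNReal.ofReal (p.1.weight β) * ENNReal.ofReal (p.2.weight β) else 0
  rw [step1]
  -- freeze the cluster and apply the frozen-cluster identity
  have step2 : ∀ S : Finset V,
      (∑' p : Current G × Current G, if clusterOff G (p.1 + p.2) (dartEdge G d) v = S then
        (if (Current.IsSupp (offGraph G A) p.1 ∧ p.1.sources = ∅) ∧
            (p.2.sources = (({v} : Finset V) ∆ {x}) ∆ ({d.fst} ∆ {d.snd}) ∧ Even (p.2 (dartEdge G d)) ∧
              Even (p.1 (dartEdge G d)) ∧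
                laceEvent G (Function.update (p.1 + p.2) (dartEdge G d) 0) A v d.fst ∧
                  ConnAvoid G (p.1 + p.2) S d.snd x)
          then ENNReal.ofReal (p.1.weight β) * ENNReal.ofReal (p.2.weight β) else 0) else 0) =
      (∑' p : Current G × Current G,
        (if (Current.IsSupp (offGraph G A) p.1 ∧ p.1.sources = ∅) ∧
            (p.2.sources = ({v} : Finset V) ∆ {d.fst} ∧ Even (p.2 (dartEdge G d)) ∧
              Even (p.1 (dartEdge G d)) ∧
                laceEvent G (Function.update (p.1 + p.2) (dartEdge G d) 0) A v d.fst ∧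
                  clusterOff G (p.1 + p.2) (dartEdge G d) v = S)
          then ENNReal.ofReal (p.1.weight β) * ENNReal.ofReal (p.2.weight β) else 0)) *
        ENNReal.ofReal (twoPointOff G β S d.snd x) := by
    intro S
    rw [← frozen_cluster_eq₂ hβ x (dartEdge G d) hb A S]
    refine tsum_congr fun p => ?_
    by_cases hS : clusterOff G (p.1 + p.2) (dartEdge G d) v = S
    · rw [if_pos hS]
      exact if_congr ⟨fun h => ⟨h.1, h.2.1, h.2.2.1, h.2.2.2.1, h.2.2.2.2.1, hS, h.2.2.2.2.2⟩,
        fun h => ⟨h.1, h.2.1, h.2.2.1, h.2.2.2.1, h.2.2.2.2.1, h.2.2.2.2.2.2⟩⟩ rfl rfl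
    · rw [if_neg hS]
      exact (if_neg fun h => hS h.2.2.2.2.2.1).symm
  rw [Finset.sum_congr rfl fun S _ => step2 S]
  -- re-sum over the cluster
  have step3 := tsum_pair_eq_sum_tsum_ite_clusterOff (dartEdge G d) v fun p S =>
    if (Current.IsSupp (offGraph G A) p.1 ∧ p.1.sources = ∅) ∧
        (p.2.sources = ({v} : Finset V) ∆ {d.fst} ∧ Even (p.2 (dartEdge G d)) ∧
          Even (p.1 (dartEdge G d)) ∧
            laceEvent G (Function.update (p.1 + p.2) (dartEdge G d) 0) A v d.fst)
      then ENNReal.ofReal (p.1.weight β) * (ENNReal.ofReal (p.2.weight β) *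
        ENNReal.ofReal (twoPointOff G β S d.snd x)) else 0
  have step3' : ∀ S : Finset V,
      (∑' p : Current G × Current G,
        (if (Current.IsSupp (offGraph G A) p.1 ∧ p.1.sources = ∅) ∧
            (p.2.sources = ({v} : Finset V) ∆ {d.fst} ∧ Even (p.2 (dartEdge G d)) ∧
              Even (p.1 (dartEdge G d)) ∧
                laceEvent G (Function.update (p.1 + p.2) (dartEdge G d) 0) A v d.fst ∧
                  clusterOff G (p.1 + p.2) (dartEdge G d) v = S)
          then ENNReal.ofReal (p.1.weight β) * ENNReal.ofReal (p.2.weight β) else 0)) *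
        ENNReal.ofReal (twoPointOff G β S d.snd x) =
      ∑' p : Current G × Current G, if clusterOff G (p.1 + p.2) (dartEdge G d) v = S then
        (if (Current.IsSupp (offGraph G A) p.1 ∧ p.1.sources = ∅) ∧
            (p.2.sources = ({v} : Finset V) ∆ {d.fst} ∧ Even (p.2 (dartEdge G d)) ∧
              Even (p.1 (dartEdge G d)) ∧
                laceEvent G (Function.update (p.1 + p.2) (dartEdge G d) 0) A v d.fst)
          then ENNReal.ofReal (p.1.weight β) * (ENNReal.ofReal (p.2.weight β) *
            ENNReal.ofReal (twoPointOff G β S d.snd x)) else 0)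
        else 0 := by
    intro S
    rw [← ENNReal.tsum_mul_right]
    refine tsum_congr fun p => ?_
    by_cases hS : clusterOff G (p.1 + p.2) (dartEdge G d) v = S
    · rw [if_pos hS, ite_zero_mul]
      exact if_congr ⟨fun h => ⟨h.1, h.2.1, h.2.2.1, h.2.2.2.1, h.2.2.2.2.1⟩,
        fun h => ⟨h.1, h.2.1, h.2.2.1, h.2.2.2.1, h.2.2.2.2, hS⟩⟩ (mul_assoc _ _ _) rfl
    · rw [if_neg hS, ite_zero_mul]
      exact if_neg fun h => hS h.2.2.2.2.2
  rw [Finset.sum_congr rfl fun S _ => step3' S, ← step3]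

end IsingLace

end Literature.Probability.LatticeModels

end
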